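import Summits.AtomisticToContinuum.HydrodynamicLimit.Theorems.OneSphereInfluenceAssemblyScoreIdentity
import Summits.AtomisticToContinuum.HydrodynamicLimit.Theorems.OneSphereInfluenceAssemblyMoments
import HarnessLib

/-!
# Assembly of route `OneSphereInfluence` (stmt-AtomisticToContinuum-14700): the finite-`N` score
# identity `d/dκ E_{p_κ} F = Cov_{p_κ}(S_κ, F)`

Helper file for the assembly item `…Theses.OneSphereInfluence.Assembly`. Along a jointly smooth
path `κ ∈ [0,1] ↦ (a_κ, u₀κ, θ₀κ)` of local-Gibbs profiles (`a_κ, θ₀κ > 0`) for which the local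
Gibbs measures `p_κ = localGibbsMeasure σ a_κ u₀κ θ₀κ N` are probability measures, and for an
energy-dominated measurable observable `F` on `(N+1)`-particle phase space:

* `E_{p_κ} G = Z_κ⁻¹ ∫ 𝟙_D ∏ f_κ(zᵢ) G dz` (`integral_localGibbsMeasure_eq_inv_mul`), `Z_κ > 0`;
* **the score identity** (`hasDerivAt_integral_localGibbsMeasure`): at every interior `κ`,
  `d/dκ E_{p_κ} F = Cov_{p_κ}(S_κ, F)` with the total score
  `S_κ(z) = ∑ᵢ ∂_κ log f_κ(zᵢ)` (one-sided derivative within `[0,1]`, as in the route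
  statement `ScoreLinearResponse`) — quotient rule on the unnormalised identities of
  `OneSphereInfluenceAssemblyScoreIdentity`, then `Cov(S,F) = E[SF] - E[S]E[F]` for
  `S, F ∈ L²(p_κ)` (Gaussian moments, `OneSphereInfluenceAssemblyMoments`);
* continuity of `κ ↦ E_{p_κ} F` on `[0,1]`.

This is the "exact finite-`N` identity `d/dκ E_κ F_t = Cov_κ(S_κ, F_t)`" of the route thesis
(likelihood-ratio / score-function sensitivity). Folklore; no definitions.
-/

noncomputable section

open MeasureTheory ProbabilityTheory Filter Set Topology Real
open scoped InnerProductSpace ENNReal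

namespace Summit.AtomisticToContinuum.HydrodynamicLimit.Theorems.OneSphereInfluenceAssembly

open Literature.Analysis.FluidPDE Literature.MathematicalPhysics.KineticTheory

/-! ## Expectations under the local Gibbs measure through the unnormalised weight -/

section Static

variable {a₁ θ₁ : T3 → ℝ} {u₁ : T3 → V3}

/-- **Expectation = normalised weighted Lebesgue integral**:
`∫ G dP_N = Z⁻¹ ∫ 𝟙_D(z) ∏ᵢ f(zᵢ) G(z) dz` for the local Gibbs measure of continuous profiles
`a ≥ 0`, `θ > 0` (the law has Lebesgue density `Z⁻¹ 𝟙_D ∏ f(zᵢ)`). [folklore] -/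
theorem integral_localGibbsMeasure_eq_inv_mul (ha : Continuous a₁) (hθ : Continuous θ₁)
    (hu : Continuous u₁) (ha0 : ∀ x, 0 ≤ a₁ x) (hθ0 : ∀ x, 0 < θ₁ x) (σ : ℝ) (N : ℕ)
    (G : Config (N + 1) (Fin 3) T3 → ℝ) :
    ∫ z, G z ∂localGibbsMeasure σ a₁ u₁ θ₁ N =
      (canonicalPartition (Torus.geometry (Fin 3)) (hsDiameter σ N) (N + 1) (localGibbsProfile a₁ u₁ θ₁))⁻¹ *
        ∫ z, (hardSphereDomain (Torus.geometry (Fin 3)) (N + 1) (hsDiameter σ N)).indicator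
          (tensorPow (N + 1) (localGibbsProfile a₁ u₁ θ₁)) z * G z := by
  have hfm : Measurable (canonicalDensity (Torus.geometry (Fin 3)) (hsDiameter σ N) (N + 1)
      (localGibbsProfile a₁ u₁ θ₁)) :=
    measurable_canonicalDensity _ _ (measurable_localGibbsProfile ha hθ hu)
  have hnn : ∀ z, 0 ≤ canonicalDensity (Torus.geometry (Fin 3)) (hsDiameter σ N) (N + 1)
      (localGibbsProfile a₁ u₁ θ₁) z := fun z =>
    mul_nonneg (inv_nonneg.2 (canonicalPartition_nonneg _ _ _
      (localGibbsProfile_nonneg ha0 fun x => (hθ0 x).le)))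
      (Set.indicator_nonneg (fun w _ =>
        tensorPow_nonneg (localGibbsProfile_nonneg ha0 fun x => (hθ0 x).le) _ w) z)
  rw [localGibbsMeasure, integral_withDensity_eq_integral_toReal_smul₀ hfm.ennreal_ofReal.aemeasurable
    (Eventually.of_forall fun _ => ENNReal.ofReal_lt_top)]
  simp_rw [ENNReal.toReal_ofReal (hnn _), canonicalDensity, smul_eq_mul, mul_assoc]
  exact integral_const_mul _ _

/-- If the local Gibbs measure is a probability measure then the canonical partition function is
positive. [folklore] -/
theorem canonicalPartition_pos_of_isProbabilityMeasure (ha : Continuous a₁) (hθ : Continuous θ₁)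
    (hu : Continuous u₁) (ha0 : ∀ x, 0 ≤ a₁ x) (hθ0 : ∀ x, 0 < θ₁ x) (σ : ℝ) (N : ℕ)
    [hP : IsProbabilityMeasure (localGibbsMeasure σ a₁ u₁ θ₁ N)] :
    0 < canonicalPartition (Torus.geometry (Fin 3)) (hsDiameter σ N) (N + 1) (localGibbsProfile a₁ u₁ θ₁) := by
  rw [canonicalPartition_eq_posPartition ha hθ hu ha0 hθ0]
  have hZ0 : 0 ≤ posPartition a₁ (hsDiameter σ N) (N + 1) := posPartition_nonneg ha0 _ _
  rcases hZ0.eq_or_lt with h | h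
  · exfalso
    have huniv := hP.measure_univ
    rw [localGibbsMeasure_univ ha hθ hu ha0 hθ0 σ N, ← h] at huniv
    simp at huniv
  · exact h

end Static

/-! ## The score identity along a smooth path -/

section Path

variable {a θ₀ : ℝ → T3 → ℝ} {u₀ : ℝ → T3 → V3}
  (ha : Literature.Analysis.FunctionSpaces.Torus.IsSmoothSpaceTimeOn (Icc 0 1) a)
  (hθ : Literature.Analysis.FunctionSpaces.Torus.IsSmoothSpaceTimeOn (Icc 0 1) θ₀)
  (hu : Literature.Analysis.FunctionSpaces.Torus.IsSmoothSpaceTimeOn (Icc 0 1) u₀)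
  (ha0 : ∀ κ ∈ Icc (0 : ℝ) 1, ∀ x, 0 < a κ x) (hθ0 : ∀ κ ∈ Icc (0 : ℝ) 1, ∀ x, 0 < θ₀ κ x)
  (σ : ℝ) (N : ℕ)
  (hprob : ∀ κ ∈ Icc (0 : ℝ) 1, IsProbabilityMeasure (localGibbsMeasure σ (a κ) (u₀ κ) (θ₀ κ) N))

/-- The profile along the path. -/
local notation "prof[" κ "]" => localGibbsProfile (a κ) (u₀ κ) (θ₀ κ)
/-- The one-particle score along the path. -/
local notation "sc[" κ ", " y "]" =>
  derivWithin (fun κ' => Real.log (localGibbsProfile (a κ') (u₀ κ') (θ₀ κ') y)) (Icc 0 1) κ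
/-- The local Gibbs measure along the path. -/
local notation "P[" κ "]" => localGibbsMeasure σ (a κ) (u₀ κ) (θ₀ κ) N
/-- The canonical partition function along the path. -/
local notation "Z[" κ "]" =>
  canonicalPartition (Torus.geometry (Fin 3)) (hsDiameter σ N) (N + 1) (localGibbsProfile (a κ) (u₀ κ) (θ₀ κ))
/-- The hard-sphere domain. -/
local notation "Dom" => hardSphereDomain (Torus.geometry (Fin 3)) (N + 1) (hsDiameter σ N)

include ha hθ hu in
/-- Slices of the path are continuous profiles. [folklore] -/
theorem continuous_slices {κ : ℝ} (hκ : κ ∈ Icc (0 : ℝ) 1) :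
    Continuous (a κ) ∧ Continuous (θ₀ κ) ∧ Continuous (u₀ κ) :=
  ⟨(ha.isSmooth_slice hκ).continuous, (hθ.isSmooth_slice hκ).continuous, (hu.isSmooth_slice hκ).continuous⟩

include ha hθ hu ha0 hθ0 hprob in
/-- **Square integrability of energy-dominated observables along the path**: if
`|G| ≤ C (1 + (N+1)⁻¹ ∑ |vᵢ|²)` `p_κ`-a.e. then `G ∈ L²(p_κ)`. [folklore] -/
theorem memLp_two_path {κ : ℝ} (hκ : κ ∈ Icc (0 : ℝ) 1) {G : Config (N + 1) (Fin 3) T3 → ℝ}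
    (hGm : AEStronglyMeasurable G (P[κ])) {C : ℝ} (hC : 0 ≤ C)
    (hGb : ∀ᵐ z ∂P[κ], |G z| ≤ C * (1 + ((N + 1 : ℕ) : ℝ)⁻¹ * ∑ i, ‖(z i).2‖ ^ 2)) :
    MemLp G 2 (P[κ]) := by
  obtain ⟨hac, hθc, huc⟩ := continuous_slices ha hθ hu hκ
  obtain ⟨U, -, hU⟩ := exists_norm_le_of_isSmoothSpaceTimeOn hu
  obtain ⟨Θ, -, hΘ⟩ := exists_norm_le_of_isSmoothSpaceTimeOn hθ
  haveI := hprob κ hκ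
  exact (memLp_two_of_abs_le_energy hac hθc huc (fun x => (ha0 κ hκ x).le) (hθ0 κ hκ)
    (fun x => hU κ hκ x) (fun x => (le_abs_self _).trans (by simpa [Real.norm_eq_abs] using hΘ κ hκ x))
    σ N hGm hC hGb).1

include ha hθ hu ha0 hθ0 hprob in
/-- The total score `S_κ` is in `L²(p_κ)`. [folklore] -/
theorem memLp_two_scoreSum {κ : ℝ} (hκ : κ ∈ Icc (0 : ℝ) 1) :
    MemLp (fun z : Config (N + 1) (Fin 3) T3 => ∑ i, sc[κ, z i]) 2 (P[κ]) := by
  obtain ⟨A, hA0, hA⟩ := exists_abs_score_le ha hθ hu ha0 hθ0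
  refine memLp_two_path ha hθ hu ha0 hθ0 σ N hprob hκ
    (continuous_scoreSum ha hθ hu ha0 hθ0 hκ (N + 1)).aestronglyMeasurable
    (C := A * ((N + 1 : ℕ) : ℝ)) (by positivity) (Eventually.of_forall fun z => ?_)
  have hn : (0 : ℝ) < ((N + 1 : ℕ) : ℝ) := by positivity
  calc |∑ i, sc[κ, z i]| ≤ ∑ i, A * (1 + ‖(z i).2‖ ^ 2) :=
        (Finset.abs_sum_le_sum_abs _ _).trans (Finset.sum_le_sum fun i _ => hA κ hκ (z i))
    _ = A * ((N + 1 : ℕ) : ℝ) * (1 + ((N + 1 : ℕ) : ℝ)⁻¹ * ∑ i, ‖(z i).2‖ ^ 2) := by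
        rw [← Finset.mul_sum, Finset.sum_add_distrib]
        simp only [Finset.sum_const, Finset.card_univ, Fintype.card_fin, nsmul_eq_mul, mul_one]
        field_simp

include ha hθ hu ha0 hθ0 hprob in
/-- An observable that is energy dominated Lebesgue-a.e. on the hard-sphere domain is in `L²(p_κ)`
(the law is absolutely continuous with density supported in the domain). [folklore] -/
theorem memLp_two_of_ae_dom {κ : ℝ} (hκ : κ ∈ Icc (0 : ℝ) 1) {F : Config (N + 1) (Fin 3) T3 → ℝ}
    (hFm : Measurable F) {K : ℝ} (hK : 0 ≤ K)
    (hFb : ∀ᵐ z ∂(volume : Measure (Config (N + 1) (Fin 3) T3)),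
      z ∈ Dom → |F z| ≤ K * (1 + ∑ i, ‖(z i).2‖ ^ 2)) :
    MemLp F 2 (P[κ]) := by
  obtain ⟨hac, hθc, huc⟩ := continuous_slices ha hθ hu hκ
  have hn : (0 : ℝ) < ((N + 1 : ℕ) : ℝ) := by positivity
  have hfm : Measurable fun z => ENNReal.ofReal (canonicalDensity (Torus.geometry (Fin 3)) (hsDiameter σ N)
      (N + 1) (prof[κ]) z) :=
    (measurable_canonicalDensity _ _ (measurable_localGibbsProfile hac hθc huc)).ennreal_ofReal
  refine memLp_two_path ha hθ hu ha0 hθ0 σ N hprob hκ hFm.aestronglyMeasurable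
    (C := K * ((N + 1 : ℕ) : ℝ)) (by positivity) ?_
  rw [localGibbsMeasure, ae_withDensity_iff hfm]
  filter_upwards [hFb] with z hz hρ
  have hzD : z ∈ Dom := by
    by_contra h
    exact hρ (by rw [canonicalDensity_eq_zero_of_notMem _ _ _ _ h, ENNReal.ofReal_zero])
  refine (hz hzD).trans ?_
  rw [mul_add, mul_add, mul_one, mul_one, mul_assoc, ← mul_assoc (((N + 1 : ℕ) : ℝ)),
    mul_inv_cancel₀ hn.ne', one_mul]
  have h1 : (1 : ℝ) ≤ ((N + 1 : ℕ) : ℝ) := by exact_mod_cast Nat.succ_pos N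
  nlinarith

include ha hθ hu ha0 hθ0 hprob in
/-- **The finite-`N` score identity.** For an energy-dominated measurable observable `F` and an
interior `κ ∈ (0,1)`: `d/dκ ∫ F dp_κ = Cov_{p_κ}(S_κ, F)`, `S_κ(z) = ∑ᵢ ∂_κ log f_κ(zᵢ)`
(derivative within `[0,1]`). Proof: `E_{p_κ} F = J_F(κ)/Z(κ)` with `J_F' = ∫ w S F`, `Z' = ∫ w S`
(`hasDerivAt_integral_weight_mul`), quotient rule, and `Cov(S,F) = E[SF] - E[S]E[F]` for
`S, F ∈ L²(p_κ)`. [folklore] -/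
theorem hasDerivAt_integral_localGibbsMeasure {F : Config (N + 1) (Fin 3) T3 → ℝ}
    (hFm : Measurable F) {K : ℝ} (hK : 0 ≤ K)
    (hFb : ∀ᵐ z ∂(volume : Measure (Config (N + 1) (Fin 3) T3)),
      z ∈ Dom → |F z| ≤ K * (1 + ∑ i, ‖(z i).2‖ ^ 2))
    {κ : ℝ} (hκ : κ ∈ Ioo (0 : ℝ) 1) :
    HasDerivAt (fun κ' => ∫ z, F z ∂P[κ'])
      (cov[fun z => ∑ i, sc[κ, z i], F; P[κ]]) κ := by
  have hsub : Ioo (0 : ℝ) 1 ⊆ Icc 0 1 := Ioo_subset_Icc_self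
  have hκ' : κ ∈ Icc (0 : ℝ) 1 := hsub hκ
  haveI := hprob κ hκ'
  obtain ⟨hac, hθc, huc⟩ := continuous_slices ha hθ hu hκ'
  have ha0' : ∀ x, 0 ≤ a κ x := fun x => (ha0 κ hκ' x).le
  -- the unnormalised identities
  have h1b : ∀ᵐ z ∂(volume : Measure (Config (N + 1) (Fin 3) T3)),
      z ∈ Dom → |(1 : ℝ)| ≤ 1 * (1 + ∑ i, ‖(z i).2‖ ^ 2) :=
    Eventually.of_forall fun z _ => by rw [abs_one, one_mul]; exact le_add_of_nonneg_right (by positivity)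
  have hJF := hasDerivAt_integral_weight_mul ha hθ hu ha0 hθ0 σ N hFm hK hFb hκ
  have hJ1 := hasDerivAt_integral_weight_mul ha hθ hu ha0 hθ0 σ N measurable_const zero_le_one h1b hκ
  simp only [mul_one] at hJ1
  have hZpos : 0 < Z[κ] := canonicalPartition_pos_of_isProbabilityMeasure hac hθc huc ha0' (hθ0 κ hκ') σ N
  have hZeq : ∀ κ', Z[κ'] = ∫ z, (Dom).indicator (tensorPow (N + 1) (prof[κ'])) z := fun κ' => rfl
  -- `E_{p_κ'} F = J_F(κ') / Z(κ')` near `κ`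
  have hEeq : (fun κ' => ∫ z, F z ∂P[κ']) =ᶠ[𝓝 κ]
      fun κ' => (∫ z, (Dom).indicator (tensorPow (N + 1) (prof[κ'])) z * F z) /
        ∫ z, (Dom).indicator (tensorPow (N + 1) (prof[κ'])) z := by
    filter_upwards [Ioo_mem_nhds hκ.1 hκ.2] with κ' hκ''
    obtain ⟨hac', hθc', huc'⟩ := continuous_slices ha hθ hu (hsub hκ'')
    rw [integral_localGibbsMeasure_eq_inv_mul hac' hθc' huc' (fun x => (ha0 κ' (hsub hκ'') x).le)
      (hθ0 κ' (hsub hκ'')) σ N F, ← hZeq, inv_mul_eq_div]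
  have hdiv := (hJF.div hJ1 (by rw [← hZeq]; exact hZpos.ne')).congr_of_eventuallyEq hEeq
  refine hdiv.congr_deriv ?_
  -- identify the derivative with the covariance
  have hS2 := memLp_two_scoreSum ha hθ hu ha0 hθ0 σ N hprob hκ'
  have hF2 := memLp_two_of_ae_dom ha hθ hu ha0 hθ0 σ N hprob hκ' hFm hK hFb
  rw [covariance_eq_sub hS2 hF2]
  have hE := fun G => integral_localGibbsMeasure_eq_inv_mul hac hθc huc ha0' (hθ0 κ hκ') σ N G
  rw [hE, hE, hE F, ← hZeq]
  simp only [Pi.mul_apply]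
  field_simp

include ha hθ hu ha0 hθ0 hprob in
/-- **Continuity of `κ ↦ E_{p_κ} F` on `[0,1]`** for an energy-dominated measurable observable.
[folklore] -/
theorem continuousOn_integral_localGibbsMeasure {F : Config (N + 1) (Fin 3) T3 → ℝ}
    (hFm : Measurable F) {K : ℝ} (hK : 0 ≤ K)
    (hFb : ∀ᵐ z ∂(volume : Measure (Config (N + 1) (Fin 3) T3)),
      z ∈ Dom → |F z| ≤ K * (1 + ∑ i, ‖(z i).2‖ ^ 2)) :
    ContinuousOn (fun κ' => ∫ z, F z ∂P[κ']) (Icc 0 1) := by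
  have h1b : ∀ᵐ z ∂(volume : Measure (Config (N + 1) (Fin 3) T3)),
      z ∈ Dom → |(1 : ℝ)| ≤ 1 * (1 + ∑ i, ‖(z i).2‖ ^ 2) :=
    Eventually.of_forall fun z _ => by rw [abs_one, one_mul]; exact le_add_of_nonneg_right (by positivity)
  have hJF := continuousOn_integral_weight_mul ha hθ hu ha0 hθ0 σ N hFm hK hFb
  have hJ1 := continuousOn_integral_weight_mul ha hθ hu ha0 hθ0 σ N measurable_const zero_le_one h1b
  simp only [mul_one] at hJ1
  have hZeq : ∀ κ', Z[κ'] = ∫ z, (Dom).indicator (tensorPow (N + 1) (prof[κ'])) z := fun κ' => rfl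
  have hZne : ∀ κ' ∈ Icc (0 : ℝ) 1, (∫ z, (Dom).indicator (tensorPow (N + 1) (prof[κ'])) z) ≠ 0 := by
    intro κ' hκ'
    obtain ⟨hac, hθc, huc⟩ := continuous_slices ha hθ hu hκ'
    haveI := hprob κ' hκ'
    rw [← hZeq]
    exact (canonicalPartition_pos_of_isProbabilityMeasure hac hθc huc (fun x => (ha0 κ' hκ' x).le)
      (hθ0 κ' hκ') σ N).ne'
  refine (hJF.div hJ1 hZne).congr fun κ' hκ' => ?_
  obtain ⟨hac, hθc, huc⟩ := continuous_slices ha hθ hu hκ'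
  simp only [Pi.div_apply]
  rw [integral_localGibbsMeasure_eq_inv_mul hac hθc huc (fun x => (ha0 κ' hκ' x).le) (hθ0 κ' hκ') σ N F,
    ← hZeq, inv_mul_eq_div]

end Path

end Summit.AtomisticToContinuum.HydrodynamicLimit.Theorems.OneSphereInfluenceAssembly

end
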